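import Summits.QuantumFields.BalabanUV.Beta.FP.PerfectPropagatorSymbol
import Summits.QuantumFields.BalabanUV.Beta.FP.PerfectSymbol166Flat
import Literature.Probability.LatticeModels.LatticeGreenFunction
import Summits.QuantumFields.BalabanUV.Beta.FP.PerfectPropagatorBound

/-!
# `BalabanUV.Beta.FP.PerfectPropagatorSplit` — road «FP» for binder row D1, leaf H2-P of the horizontal route, SUPPLIER sub-row «H2-P-SPLIT-B»
# (`HOME/b2b-balaban-beta-d1-p3/LEAVES-FP.md`, `H2-DESIGN.md` §5): at the SYMBOL level, the unconstrained perfect propagator splits as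
# `PinfSym s ph = 𝟙/‖ph‖² + B(s)` with the REMAINDER `B` BOUNDED on the punctured real Brillouin zone — `‖B α β‖ ≤ 2d²·CW d/γ`, `γ = (4/π²)^{d+2}`

HONEST DEPENDENCY (page 1, mandatory): continuum YM on T⁴ ⇐ BetaPertH ∧ nine spine estimates (0/9 proved); BetaPertH ⇐ (D1) ∧ (D4) ∧ CAP+tail;
G-an2-4 gates asym, D1 and NE2/3/4.  HONEST FRAMING (cell contract, verbatim): «discharging `BetaPertH` makes Bałaban's UV stability UNCONDITIONAL —
a real constructive-QFT result; it is NOT the continuum limit and NOT the Clay problem.»  THIS MODULE DISCHARGES NOTHING of the wall: Mathlib matrix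
algebra over `FP/PerfectPropagatorSymbol` (p231001: `curlRow`, `maxwellMat`, `feynMat`, `PinfSym`, `PinfSym_mul_feynMat`) and the flatness theorem
`FP/PerfectSymbol166Flat.abs_re_W166Inf_ofReal_sub_one_le_d1` (W166-FLAT) BY NAME.  0 data def; no `def … : Prop`; nothing cited as a hypothesis;
0 sorry; 0 wall binders; NOT D1, NOT BetaPertH, NOT continuum, NOT Clay.

ABSOLUTE RULE (cell charter, verbatim): «No internally-minted statement may enter as a cited fact. Every hypothesis is either kernel-proved in this package or a
verbatim quotation of a PUBLISHED theorem with page reference. The manuscript(s) under audit are NOT citable for their own disputed steps — they are the thing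
under adjudication; programme-internal (2001/route/tribunal) claims are never citable.»

WHAT.  Write `‖ph‖² := Σ_μ ‖ph μ‖²` and `R := maxwellMat (W − 1) ph` (the weighted Maxwell matrix of the EXCESS weights).
* §1 [folklore] `maxwellMat` is ℝ-linear in the weights (`maxwellMat_sub`); **`maxwellMat_one`**: at the constant weights `1`,
  `maxwellMat 1 ph α β = ‖ph‖²·[α = β] − ph α·conj(ph β)` (the plain lattice Maxwell symbol `|p̂|²𝟙 − p̂p̂†` as a sum of rank-one curl projectors), hence
  **`feynMat_one`**: `feynMat 1 ph α β = ‖ph‖²·[α = β]` and `feynMat W ph α β = ‖ph‖²·[α = β] + R α β` (`feynMat_eq_normSq_add_excess`).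
* §2 [folklore] entry bounds: `‖curlRow ph μ ν γ‖ ≤ ‖ph μ‖ + ‖ph ν‖`; `‖maxwellMat V ph γ β‖ ≤ 2d·δ·‖ph‖²` whenever `|V μ ν| ≤ δ` off the diagonal
  (`norm_maxwellMat_le`).
* §3 [folklore] THE RESOLVENT IDENTITY, entrywise: if `P * feynMat W ph = 1` then `P α β − [α = β]/‖ph‖² = −(Σ_γ P α γ · R γ β)/‖ph‖²`
  (`entry_sub_free_eq`), hence `‖P α β − [α = β]/‖ph‖²‖ ≤ 2d²·δ·m` for any entry bound `‖P α γ‖ ≤ m` (`norm_entry_sub_free_le`).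
* §4 [our object] **`norm_PinfSym_sub_free_le`**: on the punctured real zone (`s ∈ BZ d`, `ph ≠ 0`), given an entry bound `‖PinfSym s ph α γ‖ ≤ m` and
  weight flatness `|Re W_∞(μ,ν; s) − 1| ≤ δ`:  `‖PinfSym s ph α β − [α = β]/‖ph‖²‖ ≤ 2d²·δ·m`;  and THE SPLIT at the road's momentum factors
  `ph := p̂(s) = (a ↦ e^{is_a} − 1)`: with W166-FLAT (`δ = CW d·‖p̂‖²`) and any coercive entry bound `m = 1/(γ‖p̂‖²)` (leaf H2-P-BND,
  `FP/PerfectPropagatorBound.norm_PinfSym_le`: `γ = (4/π²)^{d+2}`; taken here as the hypothesis `hm` so that this file does not depend on the order of landing),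
  **`norm_PinfSym_d1_sub_free_le`**: `‖PinfSym s p̂ α β − [α = β]/‖p̂‖²‖ ≤ 2d²·CW d/γ` — the remainder symbol `B` of H2-P-KER is BOUNDED, uniformly on the
  punctured zone.  (Its lattice kernel is then bounded by the same constant and tends to `0` at infinity by Riemann–Lebesgue; the free part `𝟙/‖p̂‖² = 𝟙/(2ε)`
  has kernel `latticeGreen/2·𝟙` whose germ `c₄/|z|²` two powers better is the tree's `BubbleTransfer.free_leg_bound` — H2-P-KER, owner.)
* §5 [folklore] THE FREE-PART KERNEL DICTIONARY for H2-P-KER's (K-split): for ANY symbol `G` agreeing on the real zone with `1/‖p̂(s)‖² = 1/(2ε(s))`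
  (`ε = LatticeModels.dispersion`), and `3 ≤ d`: the integrand `G(s)e^{is·z}` is integrable on the zone (`integrableOn_integrand_free`, from
  `LatticeModels.integrable_indicator_inv_dispersion`) and **`re_latticeKernel_free`**: `Re (B4ContourShift.latticeKernel G z) = latticeGreen z / 2` — the
  tree's two lattice-Fourier conventions (`BZ`/`phase` of B4 and `brillouin`/`cos` of `LatticeModels`) identified on the free propagator; so the free part of
  `Re`-kernel of `PinfSym` IS an3's free leg `gFree = latticeGreen/2` (`BubbleTransfer.free_leg_bound`: `|latticeGreen z/2 − c₄/|z|²| ≤ B/‖z‖∞⁴`, d = 4).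
Provenance: binder row G-an2-4 owner lineage gan24-p3, gen 16 (prover-b2b-balaban-gan24-p3-g16-0), 2026-08-20; supplier of road FP's H2-P-KER (owner
b2b-balaban-beta-d1-p3).
-/

noncomputable section

namespace Summit.QuantumFields.BalabanUV.Beta.FP.PerfectPropagatorSplit

open Finset Matrix
open scoped BigOperators ComplexConjugate
open Literature.MathematicalPhysics.QuantumFieldTheory.Balaban1983to89
open B4Strip (ofRealVec)
open B4ContourShift (BZ phase integrand fourierBox latticeKernel phase_eq_ofReal)
open Literature.Probability.LatticeModels (brillouin dispersion latticeGreen continuous_dispersion integrable_indicator_inv_dispersion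
  measurableSet_brillouin)
open Summit.QuantumFields.BalabanUV.Beta.FP.PerfectSymbol166 (W166Inf)
open Summit.QuantumFields.BalabanUV.Beta.FP.PerfectPropagatorSymbol (curlRow maxwellMat feynMat PinfSym PinfSym_mul_feynMat)
open Summit.QuantumFields.BalabanUV.Beta.FP.PerfectSymbol166Flat (CW CW_nonneg abs_re_W166Inf_ofReal_sub_one_le_d1)
open Summit.QuantumFields.BalabanUV.Beta.FP.PerfectPropagatorBound (norm_PinfSym_le d1Sym_ne_zero sum_norm_d1Sym_sq)
open B5Prop11Fiber (d1Sym)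

variable {d : ℕ}

/-! ## §1 Linearity in the weights; the plain Maxwell matrix; the Feynman completion at `W ≡ 1` -/

/-- [folklore] `maxwellMat` is additive/subtractive in the weights: `maxwellMat W ph − maxwellMat W′ ph = maxwellMat (W − W′) ph`. -/
theorem maxwellMat_sub (W W' : Fin d → Fin d → ℝ) (ph : Fin d → ℂ) :
    maxwellMat W ph - maxwellMat W' ph = maxwellMat (fun μ ν => W μ ν - W' μ ν) ph := by
  ext α β
  simp only [Matrix.sub_apply, maxwellMat, ← Finset.sum_sub_distrib]
  refine Finset.sum_congr rfl fun μ _ => Finset.sum_congr rfl fun ν _ => ?_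
  split_ifs with h
  · simp
  · push_cast; ring

/-- [folklore] the curl row of a diagonal pair vanishes: `curlRow ph μ μ = 0`. -/
theorem curlRow_self (ph : Fin d → ℂ) (μ α : Fin d) : curlRow ph μ μ α = 0 := by
  unfold curlRow; split_ifs <;> simp

/-- [folklore] the diagonal exclusion in `maxwellMat` is redundant (the `μ = ν` rank-one term is zero):
`maxwellMat W ph α β = Σ_μ Σ_ν ½W μ ν · conj(curlRow α)·curlRow β`. -/
theorem maxwellMat_eq_sum (W : Fin d → Fin d → ℝ) (ph : Fin d → ℂ) (α β : Fin d) :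
    maxwellMat W ph α β = ∑ μ, ∑ ν, (((1 / 2 : ℝ) * W μ ν : ℝ) : ℂ) * (conj (curlRow ph μ ν α) * curlRow ph μ ν β) := by
  unfold maxwellMat
  refine Finset.sum_congr rfl fun μ _ => Finset.sum_congr rfl fun ν _ => ?_
  split_ifs with h
  · subst h; rw [curlRow_self, curlRow_self]; simp
  · rfl

/-- [folklore] first corner sum: `Σ_μ Σ_ν conj([α=ν]ph μ)·([β=ν]ph μ) = [α = β]·Σ_μ conj(ph μ)·ph μ`. -/
theorem sum_corner₁ (ph : Fin d → ℂ) (α β : Fin d) :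
    ∑ μ, ∑ ν, conj (if α = ν then ph μ else 0) * (if β = ν then ph μ else 0)
      = if α = β then ∑ μ, conj (ph μ) * ph μ else 0 := by
  have e : ∀ μ ν : Fin d, conj (if α = ν then ph μ else 0) * (if β = ν then ph μ else 0)
      = if α = ν then (if β = ν then conj (ph μ) * ph μ else 0) else 0 := by
    intro μ ν; split_ifs <;> simp
  simp_rw [e]
  simp only [Finset.sum_ite_eq, Finset.mem_univ, if_true]
  by_cases h : α = β
  · subst h; simp
  · simp [h, Ne.symm h]

/-- [folklore] second corner sum: `Σ_μ Σ_ν conj([α=ν]ph μ)·([β=μ]ph ν) = conj(ph β)·ph α`. -/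
theorem sum_corner₂ (ph : Fin d → ℂ) (α β : Fin d) :
    ∑ μ, ∑ ν, conj (if α = ν then ph μ else 0) * (if β = μ then ph ν else 0) = conj (ph β) * ph α := by
  have e : ∀ μ ν : Fin d, conj (if α = ν then ph μ else 0) * (if β = μ then ph ν else 0)
      = if α = ν then (if β = μ then conj (ph μ) * ph ν else 0) else 0 := by
    intro μ ν; split_ifs <;> simp
  simp_rw [e]
  simp only [Finset.sum_ite_eq, Finset.mem_univ, if_true]

/-- [folklore] third corner sum: `Σ_μ Σ_ν conj([α=μ]ph ν)·([β=ν]ph μ) = conj(ph β)·ph α`. -/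
theorem sum_corner₃ (ph : Fin d → ℂ) (α β : Fin d) :
    ∑ μ, ∑ ν, conj (if α = μ then ph ν else 0) * (if β = ν then ph μ else 0) = conj (ph β) * ph α := by
  have e : ∀ μ ν : Fin d, conj (if α = μ then ph ν else 0) * (if β = ν then ph μ else 0)
      = if β = ν then (if α = μ then conj (ph ν) * ph μ else 0) else 0 := by
    intro μ ν; split_ifs <;> simp
  simp_rw [e]
  simp only [Finset.sum_ite_eq, Finset.mem_univ, if_true]

/-- [folklore] fourth corner sum: `Σ_μ Σ_ν conj([α=μ]ph ν)·([β=μ]ph ν) = [α = β]·Σ_ν conj(ph ν)·ph ν`. -/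
theorem sum_corner₄ (ph : Fin d → ℂ) (α β : Fin d) :
    ∑ μ, ∑ ν, conj (if α = μ then ph ν else 0) * (if β = μ then ph ν else 0)
      = if α = β then ∑ ν, conj (ph ν) * ph ν else 0 := by
  rw [Finset.sum_comm]
  have e : ∀ ν μ : Fin d, conj (if α = μ then ph ν else 0) * (if β = μ then ph ν else 0)
      = if α = μ then (if β = μ then conj (ph ν) * ph ν else 0) else 0 := by
    intro ν μ; split_ifs <;> simp
  simp_rw [e]
  simp only [Finset.sum_ite_eq, Finset.mem_univ, if_true]
  by_cases h : α = β
  · subst h; simp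
  · simp [h, Ne.symm h]

/-- [folklore] `((‖ph‖²) : ℂ) = Σ_μ conj(ph μ)·ph μ`. -/
theorem ofReal_sum_norm_sq (ph : Fin d → ℂ) : (((∑ μ, ‖ph μ‖ ^ 2 : ℝ)) : ℂ) = ∑ μ, conj (ph μ) * ph μ := by
  push_cast
  refine Finset.sum_congr rfl fun μ _ => ?_
  rw [mul_comm, Complex.mul_conj, Complex.normSq_eq_norm_sq]; push_cast; rfl

/-- [folklore] **THE PLAIN LATTICE MAXWELL SYMBOL** as a sum of rank-one curl projectors:
`maxwellMat 1 ph α β = ‖ph‖²·[α = β] − ph α·conj(ph β)` (`|p̂|²𝟙 − p̂p̂†`). -/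
theorem maxwellMat_one (ph : Fin d → ℂ) (α β : Fin d) :
    maxwellMat (fun _ _ => (1 : ℝ)) ph α β = (if α = β then (((∑ μ, ‖ph μ‖ ^ 2 : ℝ)) : ℂ) else 0) - ph α * conj (ph β) := by
  rw [maxwellMat_eq_sum]
  have hc : ∀ μ ν : Fin d, ((((1 / 2 : ℝ) * (1 : ℝ) : ℝ)) : ℂ) * (conj (curlRow ph μ ν α) * curlRow ph μ ν β)
      = (1 / 2 : ℂ) * (conj (curlRow ph μ ν α) * curlRow ph μ ν β) := by intro μ ν; push_cast; ring
  simp_rw [hc, ← Finset.mul_sum]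
  -- expand the curl rows into the four corner sums
  have hx : ∀ μ ν : Fin d, conj (curlRow ph μ ν α) * curlRow ph μ ν β
      = conj (if α = ν then ph μ else 0) * (if β = ν then ph μ else 0)
        - conj (if α = ν then ph μ else 0) * (if β = μ then ph ν else 0)
        - conj (if α = μ then ph ν else 0) * (if β = ν then ph μ else 0)
        + conj (if α = μ then ph ν else 0) * (if β = μ then ph ν else 0) := by
    intro μ ν; unfold curlRow; rw [map_sub]; ring
  simp_rw [hx, Finset.sum_add_distrib, Finset.sum_sub_distrib]
  rw [sum_corner₁, sum_corner₂, sum_corner₃, sum_corner₄, ofReal_sum_norm_sq]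
  split_ifs with h
  · subst h; ring
  · ring

/-- [folklore] **THE FEYNMAN COMPLETION AT CONSTANT WEIGHTS IS SCALAR**: `feynMat 1 ph α β = ‖ph‖²·[α = β]`. -/
theorem feynMat_one (ph : Fin d → ℂ) (α β : Fin d) :
    feynMat (fun _ _ => (1 : ℝ)) ph α β = if α = β then (((∑ μ, ‖ph μ‖ ^ 2 : ℝ)) : ℂ) else 0 := by
  unfold feynMat; rw [maxwellMat_one]; ring

/-- [folklore] **SCALAR PART + EXCESS**: `feynMat W ph α β = ‖ph‖²·[α = β] + maxwellMat (W − 1) ph α β`. -/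
theorem feynMat_eq_normSq_add_excess (W : Fin d → Fin d → ℝ) (ph : Fin d → ℂ) (α β : Fin d) :
    feynMat W ph α β = (if α = β then (((∑ μ, ‖ph μ‖ ^ 2 : ℝ)) : ℂ) else 0) + maxwellMat (fun μ ν => W μ ν - 1) ph α β := by
  have h1 := feynMat_one ph α β
  have hsub := congrFun (congrFun (maxwellMat_sub W (fun _ _ => (1 : ℝ)) ph) α) β
  simp only [Matrix.sub_apply] at hsub
  unfold feynMat at h1 ⊢
  rw [← h1, ← hsub]; ring

/-! ## §2 Entry bounds of the excess matrix -/

/-- [folklore] `‖curlRow ph μ ν γ‖ ≤ ‖ph μ‖ + ‖ph ν‖`. -/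
theorem norm_curlRow_le (ph : Fin d → ℂ) (μ ν γ : Fin d) : ‖curlRow ph μ ν γ‖ ≤ ‖ph μ‖ + ‖ph ν‖ := by
  unfold curlRow
  refine (norm_sub_le _ _).trans (add_le_add ?_ ?_) <;> split_ifs <;> simp

/-- [folklore] **ENTRY BOUND OF A WEIGHTED MAXWELL MATRIX WITH SMALL WEIGHTS**: if `|V μ ν| ≤ δ` for `μ ≠ ν` (`0 ≤ δ`) then
`‖maxwellMat V ph γ β‖ ≤ 2d·δ·‖ph‖²`. -/
theorem norm_maxwellMat_le {V : Fin d → Fin d → ℝ} {δ : ℝ} (hδ : 0 ≤ δ) (hV : ∀ μ ν, μ ≠ ν → |V μ ν| ≤ δ) (ph : Fin d → ℂ) (γ β : Fin d) :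
    ‖maxwellMat V ph γ β‖ ≤ 2 * d * δ * ∑ μ, ‖ph μ‖ ^ 2 := by
  unfold maxwellMat
  have hterm : ∀ μ ν : Fin d,
      ‖(if μ = ν then (0 : ℂ) else (((1 / 2 : ℝ) * V μ ν : ℝ) : ℂ) * (conj (curlRow ph μ ν γ) * curlRow ph μ ν β))‖
        ≤ δ * (‖ph μ‖ ^ 2 + ‖ph ν‖ ^ 2) := by
    intro μ ν
    split_ifs with h
    · rw [norm_zero]; positivity
    · rw [norm_mul, norm_mul, Complex.norm_real, Real.norm_eq_abs, abs_mul, abs_of_pos (by norm_num : (0:ℝ) < 1 / 2),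
        Complex.norm_conj]
      have h1 := norm_curlRow_le ph μ ν γ
      have h2 := norm_curlRow_le ph μ ν β
      have hVμν := hV μ ν h
      have hprod : ‖curlRow ph μ ν γ‖ * ‖curlRow ph μ ν β‖ ≤ (‖ph μ‖ + ‖ph ν‖) ^ 2 := by
        rw [sq]; exact mul_le_mul h1 h2 (norm_nonneg _) ((norm_nonneg _).trans h1)
      have hsq : (‖ph μ‖ + ‖ph ν‖) ^ 2 ≤ 2 * (‖ph μ‖ ^ 2 + ‖ph ν‖ ^ 2) := by nlinarith [sq_nonneg (‖ph μ‖ - ‖ph ν‖)]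
      have hcc : 0 ≤ ‖curlRow ph μ ν γ‖ * ‖curlRow ph μ ν β‖ := mul_nonneg (norm_nonneg _) (norm_nonneg _)
      calc 1 / 2 * |V μ ν| * (‖curlRow ph μ ν γ‖ * ‖curlRow ph μ ν β‖) ≤ 1 / 2 * δ * (2 * (‖ph μ‖ ^ 2 + ‖ph ν‖ ^ 2)) :=
            mul_le_mul (mul_le_mul_of_nonneg_left hVμν (by norm_num)) (hprod.trans hsq) hcc (by positivity)
        _ = δ * (‖ph μ‖ ^ 2 + ‖ph ν‖ ^ 2) := by ring
  calc ‖∑ μ, ∑ ν, (if μ = ν then (0 : ℂ) else (((1 / 2 : ℝ) * V μ ν : ℝ) : ℂ) * (conj (curlRow ph μ ν γ) * curlRow ph μ ν β))‖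
      ≤ ∑ μ, ‖∑ ν, (if μ = ν then (0 : ℂ) else (((1 / 2 : ℝ) * V μ ν : ℝ) : ℂ) * (conj (curlRow ph μ ν γ) * curlRow ph μ ν β))‖ :=
        norm_sum_le _ _
    _ ≤ ∑ μ, ∑ ν, ‖(if μ = ν then (0 : ℂ) else (((1 / 2 : ℝ) * V μ ν : ℝ) : ℂ) * (conj (curlRow ph μ ν γ) * curlRow ph μ ν β))‖ :=
        Finset.sum_le_sum fun μ _ => norm_sum_le _ _
    _ ≤ ∑ μ, ∑ ν, δ * (‖ph μ‖ ^ 2 + ‖ph ν‖ ^ 2) := Finset.sum_le_sum fun μ _ => Finset.sum_le_sum fun ν _ => hterm μ ν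
    _ = 2 * d * δ * ∑ μ, ‖ph μ‖ ^ 2 := by
        simp only [mul_add, Finset.sum_add_distrib, Finset.sum_const, Finset.card_univ, Fintype.card_fin, nsmul_eq_mul, ← Finset.mul_sum]
        ring

/-! ## §3 The resolvent identity and the remainder bound (abstract inverse) -/

/-- [folklore] **THE RESOLVENT IDENTITY, ENTRYWISE**: if `P * feynMat W ph = 1` and `ph ≠ 0` then, with `R := maxwellMat (W − 1) ph`,
`P α β − [α = β]/‖ph‖² = −(Σ_γ P α γ · R γ β)/‖ph‖²`. -/
theorem entry_sub_free_eq {W : Fin d → Fin d → ℝ} {ph : Fin d → ℂ} {P : Matrix (Fin d) (Fin d) ℂ}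
    (hP : P * feynMat W ph = 1) (hph : 0 < ∑ μ, ‖ph μ‖ ^ 2) (α β : Fin d) :
    P α β - (if α = β then ((((∑ μ, ‖ph μ‖ ^ 2 : ℝ))⁻¹ : ℝ) : ℂ) else 0)
      = -(((((∑ μ, ‖ph μ‖ ^ 2 : ℝ))⁻¹ : ℝ) : ℂ) * ∑ γ, P α γ * maxwellMat (fun μ ν => W μ ν - 1) ph γ β) := by
  set c : ℝ := ∑ μ, ‖ph μ‖ ^ 2 with hc
  have hc0 : (c : ℂ) ≠ 0 := Complex.ofReal_ne_zero.mpr hph.ne'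
  -- the (α, β) entry of `P * feynMat = 1`
  have h := congrFun (congrFun hP α) β
  rw [Matrix.mul_apply, Matrix.one_apply] at h
  have hsplit : ∑ γ, P α γ * feynMat W ph γ β = (c : ℂ) * P α β + ∑ γ, P α γ * maxwellMat (fun μ ν => W μ ν - 1) ph γ β := by
    have e : ∀ γ, P α γ * feynMat W ph γ β
        = P α γ * (if γ = β then ((c : ℝ) : ℂ) else 0) + P α γ * maxwellMat (fun μ ν => W μ ν - 1) ph γ β := by
      intro γ; rw [feynMat_eq_normSq_add_excess]; ring
    simp_rw [e, Finset.sum_add_distrib, mul_ite, mul_zero, Finset.sum_ite_eq', Finset.mem_univ, if_true]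
    ring
  rw [hsplit] at h
  -- solve for `P α β`
  have hsol : P α β = ((c : ℂ))⁻¹ * ((if α = β then (1 : ℂ) else 0) - ∑ γ, P α γ * maxwellMat (fun μ ν => W μ ν - 1) ph γ β) := by
    field_simp
    linear_combination h
  rw [hsol]
  push_cast
  split_ifs <;> ring

/-- [folklore] **THE REMAINDER BOUND (abstract)**: if `P * feynMat W ph = 1`, `‖P α γ‖ ≤ m` for all `γ`, and `|W μ ν − 1| ≤ δ` off the diagonal
(`0 ≤ δ`), then `‖P α β − [α = β]/‖ph‖²‖ ≤ 2d²·δ·m`. -/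
theorem norm_entry_sub_free_le {W : Fin d → Fin d → ℝ} {ph : Fin d → ℂ} {P : Matrix (Fin d) (Fin d) ℂ}
    (hP : P * feynMat W ph = 1) (hph : 0 < ∑ μ, ‖ph μ‖ ^ 2) {δ m : ℝ} (hδ : 0 ≤ δ)
    (hW : ∀ μ ν, μ ≠ ν → |W μ ν - 1| ≤ δ) (α : Fin d) (hm : ∀ γ, ‖P α γ‖ ≤ m) (β : Fin d) :
    ‖P α β - (if α = β then ((((∑ μ, ‖ph μ‖ ^ 2 : ℝ))⁻¹ : ℝ) : ℂ) else 0)‖ ≤ 2 * d ^ 2 * δ * m := by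
  set c : ℝ := ∑ μ, ‖ph μ‖ ^ 2 with hc
  rw [entry_sub_free_eq hP hph, norm_neg, norm_mul, Complex.norm_real, Real.norm_eq_abs, abs_of_pos (inv_pos.mpr hph)]
  have hm0 : 0 ≤ m := (norm_nonneg _).trans (hm β)
  have hR : ∀ γ, ‖maxwellMat (fun μ ν => W μ ν - 1) ph γ β‖ ≤ 2 * d * δ * c := fun γ => norm_maxwellMat_le hδ hW ph γ β
  have hsum : ‖∑ γ, P α γ * maxwellMat (fun μ ν => W μ ν - 1) ph γ β‖ ≤ d * (m * (2 * d * δ * c)) := by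
    calc ‖∑ γ, P α γ * maxwellMat (fun μ ν => W μ ν - 1) ph γ β‖ ≤ ∑ γ, ‖P α γ * maxwellMat (fun μ ν => W μ ν - 1) ph γ β‖ := norm_sum_le _ _
      _ ≤ ∑ _γ : Fin d, m * (2 * d * δ * c) := Finset.sum_le_sum fun γ _ => by
          rw [norm_mul]; exact mul_le_mul (hm γ) (hR γ) (norm_nonneg _) hm0
      _ = d * (m * (2 * d * δ * c)) := by simp
  calc c⁻¹ * ‖∑ γ, P α γ * maxwellMat (fun μ ν => W μ ν - 1) ph γ β‖ ≤ c⁻¹ * (d * (m * (2 * d * δ * c))) :=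
        mul_le_mul_of_nonneg_left hsum (inv_pos.mpr hph).le
    _ = 2 * d ^ 2 * δ * m := by field_simp

/-! ## §4 The perfect propagator symbol: the remainder is bounded on the punctured real zone -/

/-- [our object] **REMAINDER BOUND FOR THE PERFECT PROPAGATOR SYMBOL**, any momentum factors: on the real zone (`s ∈ BZ d`), for `ph ≠ 0`, an entry bound
`‖PinfSym s ph α γ‖ ≤ m` and weight flatness `|Re W_∞(μ,ν; s) − 1| ≤ δ` (`0 ≤ δ`) give `‖PinfSym s ph α β − [α = β]/‖ph‖²‖ ≤ 2d²·δ·m`. -/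
theorem norm_PinfSym_sub_free_le {s : Fin d → ℝ} (hs : s ∈ BZ d) {ph : Fin d → ℂ} (hph : ph ≠ 0) {δ m : ℝ} (hδ : 0 ≤ δ)
    (hW : ∀ μ ν, μ ≠ ν → |(W166Inf μ ν (ofRealVec s)).re - 1| ≤ δ) (α : Fin d) (hm : ∀ γ, ‖PinfSym s ph α γ‖ ≤ m) (β : Fin d) :
    ‖PinfSym s ph α β - (if α = β then ((((∑ μ, ‖ph μ‖ ^ 2 : ℝ))⁻¹ : ℝ) : ℂ) else 0)‖ ≤ 2 * d ^ 2 * δ * m := by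
  have hph2 : 0 < ∑ μ, ‖ph μ‖ ^ 2 := by
    obtain ⟨a, ha⟩ : ∃ a, ph a ≠ 0 := by
      by_contra hall; push Not at hall; exact hph (funext hall)
    exact lt_of_lt_of_le (by positivity : (0:ℝ) < ‖ph a‖ ^ 2) (Finset.single_le_sum (fun i _ => sq_nonneg ‖ph i‖) (Finset.mem_univ a))
  exact norm_entry_sub_free_le (PinfSym_mul_feynMat hs hph) hph2 hδ hW α hm β

/-- [our object] **THE SPLIT `PinfSym = 𝟙/‖p̂‖² + B` WITH `B` BOUNDED, AT THE ROAD's MOMENTUM FACTORS `p̂(s) = (a ↦ e^{is_a} − 1)`.**  On the punctured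
real zone, given a coercive entry bound `‖PinfSym s p̂ α γ‖ ≤ 1/(γ·‖p̂‖²)` with `0 < γ` (leaf H2-P-BND supplies it with `γ = (4/π²)^{d+2}`:
`FP/PerfectPropagatorBound.norm_PinfSym_le`), W166-FLAT gives `‖PinfSym s p̂ α β − [α = β]/‖p̂‖²‖ ≤ 2d²·CW d/γ` — uniformly in `s`. -/
theorem norm_PinfSym_d1_sub_free_le {s : Fin d → ℝ} (hs : s ∈ BZ d)
    (hph : (fun a : Fin d => Complex.exp ((s a : ℂ) * Complex.I) - 1) ≠ 0) {γ : ℝ} (hγ : 0 < γ) (α : Fin d)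
    (hm : ∀ γ', ‖PinfSym s (fun a => Complex.exp ((s a : ℂ) * Complex.I) - 1) α γ'‖
      ≤ 1 / (γ * ∑ a, ‖Complex.exp ((s a : ℂ) * Complex.I) - 1‖ ^ 2)) (β : Fin d) :
    ‖PinfSym s (fun a => Complex.exp ((s a : ℂ) * Complex.I) - 1) α β
        - (if α = β then ((((∑ a, ‖Complex.exp ((s a : ℂ) * Complex.I) - 1‖ ^ 2 : ℝ))⁻¹ : ℝ) : ℂ) else 0)‖
      ≤ 2 * d ^ 2 * CW d / γ := by
  set ph : Fin d → ℂ := fun a => Complex.exp ((s a : ℂ) * Complex.I) - 1 with hph_def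
  set c : ℝ := ∑ a, ‖Complex.exp ((s a : ℂ) * Complex.I) - 1‖ ^ 2 with hc
  have hc0 : 0 < c := by
    obtain ⟨a, ha⟩ : ∃ a, ph a ≠ 0 := by
      by_contra hall; push Not at hall; exact hph (funext hall)
    exact lt_of_lt_of_le (by positivity : (0:ℝ) < ‖ph a‖ ^ 2) (Finset.single_le_sum (fun i _ => sq_nonneg ‖ph i‖) (Finset.mem_univ a))
  have hflat : ∀ μ ν, μ ≠ ν → |(W166Inf μ ν (ofRealVec s)).re - 1| ≤ CW d * c :=
    fun μ ν _ => abs_re_W166Inf_ofReal_sub_one_le_d1 μ ν hs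
  have hδ : 0 ≤ CW d * c := mul_nonneg (CW_nonneg d) hc0.le
  have h := norm_PinfSym_sub_free_le hs hph hδ hflat α hm β
  calc _ ≤ 2 * d ^ 2 * (CW d * c) * (1 / (γ * c)) := h
    _ = 2 * d ^ 2 * CW d / γ := by field_simp


/-! ## §5 The free part: `Re`-lattice kernel of `1/‖p̂‖²` is `latticeGreen/2` -/

/- The two Brillouin zones of the tree coincide, `B4ContourShift.BZ d = LatticeModels.brillouin d` (tree: `T4Continuum.G183FreePartRate.BZ_eq_brillouin`,
not imported here to keep road FP's closure small; the one-line proof is inlined as `hBZ` below). -/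

/-- [folklore] `‖p̂(s)‖² = 2ε(s)`: `Σ_a ‖e^{is_a} − 1‖² = 2·Σ_a (1 − cos s_a)`. -/
theorem sum_norm_d1_sq_eq_two_mul_dispersion (s : Fin d → ℝ) :
    ∑ a, ‖Complex.exp ((s a : ℂ) * Complex.I) - 1‖ ^ 2 = 2 * dispersion s := by
  rw [← Summit.QuantumFields.BalabanUV.Beta.FP.PerfectSymbol166FlatFactors.sum_S1r_eq_sum_norm_d1_sq,
    Summit.QuantumFields.BalabanUV.Beta.FP.PerfectSymbol166FlatFactors.sum_S1r_eq_two_mul_dispersion]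
  rfl

/-- [folklore] the real free integrand `s ↦ (2ε(s))⁻¹·e^{is·z}` is integrable on the zone in `d ≥ 3` (`LatticeModels.integrable_indicator_inv_dispersion`). -/
theorem integrableOn_free_mul_cexp (hd : 3 ≤ d) (z : Fin d → ℤ) :
    MeasureTheory.IntegrableOn (fun s : Fin d → ℝ => ((((2 * dispersion s)⁻¹ : ℝ)) : ℂ) * Complex.exp (Complex.I * phase s z)) (BZ d) := by
  have hI : MeasureTheory.IntegrableOn (fun s : Fin d → ℝ => 1 / dispersion s) (brillouin d) :=
    (MeasureTheory.integrable_indicator_iff (measurableSet_brillouin d)).mp (integrable_indicator_inv_dispersion d hd)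
  rw [(show BZ d = brillouin d from by unfold BZ brillouin; exact (Set.pi_univ_Icc _ _).symm)]
  refine MeasureTheory.Integrable.mono hI ?_ (MeasureTheory.ae_of_all _ fun s => ?_)
  · refine ((Complex.continuous_ofReal.measurable.comp ((continuous_dispersion (d := d)).measurable.const_mul 2).inv).mul ?_).aestronglyMeasurable
    refine (Complex.continuous_exp.comp (continuous_const.mul ?_)).measurable
    unfold phase
    exact continuous_finsetSum _ fun μ _ => (Complex.continuous_ofReal.comp (continuous_apply μ)).mul continuous_const
  · rw [norm_mul, B4ContourShift.norm_cexp_phase, mul_one, Complex.norm_real, Real.norm_eq_abs, Real.norm_eq_abs]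
    have hε := Literature.Probability.LatticeModels.dispersion_nonneg s
    rw [abs_of_nonneg (by positivity), abs_of_nonneg (div_nonneg zero_le_one hε)]
    rcases eq_or_lt_of_le hε with h0 | hpos
    · rw [← h0]; simp
    · rw [← one_div]
      exact one_div_le_one_div_of_le hpos (by linarith)

/-- [folklore] … hence the B4 integrand of ANY symbol `G` that agrees with `1/(2ε)` on the real zone is integrable there. -/
theorem integrableOn_integrand_free (hd : 3 ≤ d) {G : (Fin d → ℂ) → ℂ}
    (hG : ∀ s ∈ BZ d, G (ofRealVec s) = ((((2 * dispersion s)⁻¹ : ℝ)) : ℂ)) (z : Fin d → ℤ) :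
    MeasureTheory.IntegrableOn (integrand G z) (BZ d) := by
  refine (integrableOn_free_mul_cexp hd z).congr_fun (fun s hs => ?_) (by rw [(show BZ d = brillouin d from by unfold BZ brillouin; exact (Set.pi_univ_Icc _ _).symm)]; exact measurableSet_brillouin d)
  unfold integrand; rw [hG s hs]

/-- [our object] **THE FREE-PART KERNEL DICTIONARY**: for any symbol `G` with `G(s) = 1/(2ε(s)) = 1/‖p̂(s)‖²` on the real zone and `3 ≤ d`,
`Re (latticeKernel G z) = latticeGreen z / 2` — the free part of the `Re`-kernel of the unconstrained perfect propagator IS an3's free table leg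
`gFree = latticeGreen/2` (germ `c₄/|z|²`, `BubbleTransfer.free_leg_bound`). -/
theorem re_latticeKernel_free (hd : 3 ≤ d) {G : (Fin d → ℂ) → ℂ}
    (hG : ∀ s ∈ BZ d, G (ofRealVec s) = ((((2 * dispersion s)⁻¹ : ℝ)) : ℂ)) (z : Fin d → ℤ) :
    (latticeKernel G z).re = latticeGreen z / 2 := by
  unfold latticeKernel fourierBox
  rw [Complex.smul_re, smul_eq_mul]
  have hcongr : ∫ s in BZ d, integrand G z s
      = ∫ s in BZ d, ((((2 * dispersion s)⁻¹ : ℝ)) : ℂ) * Complex.exp (Complex.I * phase s z) :=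
    MeasureTheory.setIntegral_congr_fun (by rw [(show BZ d = brillouin d from by unfold BZ brillouin; exact (Set.pi_univ_Icc _ _).symm)]; exact measurableSet_brillouin d) fun s hs => by unfold integrand; rw [hG s hs]
  rw [hcongr]
  have hint := integrableOn_free_mul_cexp hd z
  have hre := integral_re hint
  simp only [RCLike.re_to_complex] at hre
  rw [← hre]
  have hpt : ∀ s : Fin d → ℝ, (((((2 * dispersion s)⁻¹ : ℝ)) : ℂ) * Complex.exp (Complex.I * phase s z)).re
      = (1 / 2) * (Real.cos (∑ i, s i * (z i : ℝ)) / dispersion s) := by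
    intro s
    rw [phase_eq_ofReal, mul_comm Complex.I, Complex.re_ofReal_mul, Complex.exp_ofReal_mul_I_re]
    rw [mul_inv, div_eq_mul_inv]; ring
  simp_rw [hpt]
  rw [MeasureTheory.integral_const_mul, (show BZ d = brillouin d from by unfold BZ brillouin; exact (Set.pi_univ_Icc _ _).symm)]
  unfold latticeGreen
  field_simp


/-! ## §6 The split, unconditionally (H2-P-BND's entry bound plugged in) -/

/-- [our object] **`PinfSym s p̂ = 𝟙/(2ε(s)) + B(s)` WITH `‖B(s) α β‖ ≤ 2d²·CW d/(4/π²)^{d+2}` ON THE PUNCTURED REAL ZONE** — W166-FLAT (this lineage) + the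
coercive entry bound `PerfectPropagatorBound.norm_PinfSym_le` (leaf H2-P-BND) through the resolvent identity; `‖p̂(s)‖² = 2ε(s)` (`sum_norm_d1Sym_sq`). -/
theorem norm_PinfSym_d1Sym_sub_free_le {s : Fin d → ℝ} (hs : s ∈ BZ d) (h0 : s ≠ 0) (α β : Fin d) :
    ‖PinfSym s (d1Sym s) α β - (if α = β then ((((2 * dispersion s)⁻¹ : ℝ)) : ℂ) else 0)‖
      ≤ 2 * d ^ 2 * CW d / (4 / Real.pi ^ 2) ^ (d + 2) := by
  have hph : d1Sym s ≠ 0 := d1Sym_ne_zero hs h0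
  have e : d1Sym s = fun a : Fin d => Complex.exp ((s a : ℂ) * Complex.I) - 1 := rfl
  have hm : ∀ γ', ‖PinfSym s (fun a => Complex.exp ((s a : ℂ) * Complex.I) - 1) α γ'‖
      ≤ 1 / ((4 / Real.pi ^ 2) ^ (d + 2) * ∑ a, ‖Complex.exp ((s a : ℂ) * Complex.I) - 1‖ ^ 2) :=
    fun γ' => by simpa [e] using norm_PinfSym_le hs hph α γ'
  have h := norm_PinfSym_d1_sub_free_le hs (by rwa [e] at hph) (by positivity : (0:ℝ) < (4 / Real.pi ^ 2) ^ (d + 2)) α hm β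
  rw [sum_norm_d1_sq_eq_two_mul_dispersion] at h
  rwa [e]

/-- [our object] the same with the right-hand side as ONE explicit constant of `d`: `CB d := 2d²·CW d·(π²/4)^{d+2}`-form. -/
theorem norm_PinfSym_d1Sym_sub_free_le' {s : Fin d → ℝ} (hs : s ∈ BZ d) (h0 : s ≠ 0) (α β : Fin d) :
    ‖PinfSym s (d1Sym s) α β - (if α = β then ((((2 * dispersion s)⁻¹ : ℝ)) : ℂ) else 0)‖
      ≤ 2 * d ^ 2 * CW d * (Real.pi ^ 2 / 4) ^ (d + 2) := by
  refine (norm_PinfSym_d1Sym_sub_free_le hs h0 α β).trans (le_of_eq ?_)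
  have hπ : (0 : ℝ) < 4 / Real.pi ^ 2 := by positivity
  rw [div_eq_mul_inv, ← inv_pow, inv_div]

end Summit.QuantumFields.BalabanUV.Beta.FP.PerfectPropagatorSplit

end
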